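import Summits.AtomisticToContinuum.Crystallization.Theorems.OverbindingBudgetAffineCompressedCutPieces
import Summits.AtomisticToContinuum.Crystallization.Theorems.OverbindingBudgetAffineCompressedCutFirst

/-!
# OverbindingBudget · AffineCompressedCut — rider «Outer» (lens-4 g82, head start on (iii) = the 79K energy inequality, part VI)

Cell `decomp-a2c`, seat lens-4, generation 82.  ELEMENTARY·PROVED, no new numeric hypothesis, no new `Prop` definitions.

THE OUTER BOOKKEEPING OF THE LEAF.  At a priced site `i` of the leaf `NearFieldSlackMinSecond 12 (1/25)` (parameters
`(ρ, ρ₁, η, θ₀, s₀, s₁, ε, g) = (64, 12, 10⁻⁴, 10⁻³, 17/50, 17/20, 3/50, 1/450)`, any window floor `δ > 0`) that is `(12, 10⁻⁴, 10⁻³)`-affinely deep,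
the near load `nearLoad … 12 (i)` (three classes: priced at the scale weight `w ∈ {0, ½, 1}`, sound-unpriced at weight `1`, unsound through `max V 0`)
is bounded below by an INNER WORST-CASE SUM minus a CLOSED RATIONAL TAIL:

  ★ `inner_sub_tail_le_nearLoad`:
  `∑_{k : dist (y i) (y k) ≤ 106/25·nn_i} min (½·V(d_k)) (V(d_k)) − (197/3000)·nn_i⁻⁶ ≤ nearLoad 64 12 (1/10^4) (1/1000) (17/50) (17/20) (3/50) (1/450) δ 12 y i`.

* INNER (`d ≤ 106/25·ν`, `ν = nn_i`): a priced `k ≠ i` has `nn_k ≥ (9/10)ν` («Core»), so its weight is `½` or `1` and `w·V ≥ min (½V) V` for either sign of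
  `V`; a sound-unpriced `k` enters with `V ≥ min (½V) V`; an unsound one with `max V 0 ≥ V`; `k = i` contributes `V(0) = 0 = min 0 0`.
* OUTER (`106/25·ν < d ≤ 12ν`): every term is `≥ −d⁻⁶/6` when it pulls at all — a priced `k` with `nn_k ≤ (2/5)ν` has weight `0`, a sound-unpriced `k` has
  `nn_k ≥ s₀ = 17/50 > (2/5)ν` (as `ν < s₁ = 17/20`), an unsound `k` enters through `max V 0 ≥ 0`.  The pullers' `Σ d⁻⁶` is split at
  `219/40, 8, 47/5, 101/10, 21/2` (units `ν`) and bounded by «Pieces» (`193/1000 + 11/100 + 47/2000 + 1/100 + 13/2000 + 51/1000 = 394/1000`, floors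
  from «Core»/«Far» on the first five annuli, the pullers' own floor `(2/5)ν` on the last) ⇒ tail `≥ −(394/6000)·ν⁻⁶ = −(197/3000)·ν⁻⁶`.

What is left of (iii) for g83 («Sharp» + «Sum»): `e⋆ + c + ν⁻⁶/25 + (197/3000)·ν⁻⁶ ≤ ∑_{d ≤ 106/25·ν} min (½V) V` from the record's inner structure
(numerics `g82/numerics/ledger.py`: worst Barlow stacking, positions to `D_p`, margin `+0.27` at `ν = 17/20` with `c = 1/100`).
-/

namespace Summit.AtomisticToContinuum.Crystallization.Theorems.OverbindingBudgetAffineCompressedCutOuter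

open scoped BigOperators Classical
open Literature.MathematicalPhysics.StatisticalMechanics
open Literature.Geometry.DiscreteGeometry (nearestDist nearestDist_nonneg nearestDist_le_dist)
open Summit.AtomisticToContinuum.Crystallization.Theorems.OverbindingBudgetAffineLadder (AffDeepReg)
open Summit.AtomisticToContinuum.Crystallization.Theorems.OverbindingBudgetAffineCompressedCut (Sound Priced scaleWeight scaleWeight_nonneg
  scaleWeight_le_one nearLoad nearestDist_pos_of_priced neg_le_mul_lennardJones)
open Summit.AtomisticToContinuum.Crystallization.Theorems.OverbindingBudgetAffineCompressedCutCore (core_scale_window)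
open Summit.AtomisticToContinuum.Crystallization.Theorems.OverbindingBudgetAffineCompressedCutPieces (piece1_sum_le piece2_sum_le piece3_sum_le
  piece4_sum_le piece5_sum_le piece6_sum_le)

variable {N : ℕ}

/-- The pullers' tail: a finite index set `T` of sites with `106/25·nn_i < d ≤ 12·nn_i` and own spacing `> (2/5)·nn_i`, at an affinely deep `i`,
has `∑_{k ∈ T} d_k⁻⁶ ≤ (394/1000)·nn_i⁻⁶` — the six «Pieces» added up. [this file] -/
theorem pullers_sum_le {y : Fin N → EuclideanSpace ℝ (Fin 3)} (hy : Function.Injective y) {i : Fin N} (hν : 0 < nearestDist y i)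
    (hreg : AffDeepReg 12 (1 / 10 ^ 4) (1 / 1000) (1 / 450) y i) (T : Finset (Fin N))
    (hT : ∀ k ∈ T, 106 / 25 * nearestDist y i < dist (y i) (y k) ∧ dist (y i) (y k) ≤ 12 * nearestDist y i ∧
      2 / 5 * nearestDist y i < nearestDist y k) :
    ∑ k ∈ T, (dist (y i) (y k))⁻¹ ^ 6 ≤ 394 / 1000 * (nearestDist y i)⁻¹ ^ 6 := by
  -- split at 219/40, 8, 47/5, 101/10, 21/2
  have s1 := Finset.sum_filter_add_sum_filter_not T (fun k => dist (y i) (y k) ≤ 219 / 40 * nearestDist y i)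
    (fun k => (dist (y i) (y k))⁻¹ ^ 6)
  set T₁ := T.filter (fun k => ¬ dist (y i) (y k) ≤ 219 / 40 * nearestDist y i) with hT₁
  have s2 := Finset.sum_filter_add_sum_filter_not T₁ (fun k => dist (y i) (y k) ≤ 8 * nearestDist y i)
    (fun k => (dist (y i) (y k))⁻¹ ^ 6)
  set T₂ := T₁.filter (fun k => ¬ dist (y i) (y k) ≤ 8 * nearestDist y i) with hT₂
  have s3 := Finset.sum_filter_add_sum_filter_not T₂ (fun k => dist (y i) (y k) ≤ 47 / 5 * nearestDist y i)
    (fun k => (dist (y i) (y k))⁻¹ ^ 6)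
  set T₃ := T₂.filter (fun k => ¬ dist (y i) (y k) ≤ 47 / 5 * nearestDist y i) with hT₃
  have s4 := Finset.sum_filter_add_sum_filter_not T₃ (fun k => dist (y i) (y k) ≤ 101 / 10 * nearestDist y i)
    (fun k => (dist (y i) (y k))⁻¹ ^ 6)
  set T₄ := T₃.filter (fun k => ¬ dist (y i) (y k) ≤ 101 / 10 * nearestDist y i) with hT₄
  have s5 := Finset.sum_filter_add_sum_filter_not T₄ (fun k => dist (y i) (y k) ≤ 21 / 2 * nearestDist y i)
    (fun k => (dist (y i) (y k))⁻¹ ^ 6)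
  set T₅ := T₄.filter (fun k => ¬ dist (y i) (y k) ≤ 21 / 2 * nearestDist y i) with hT₅
  -- memberships
  have m1 : ∀ k ∈ T₁, k ∈ T ∧ 219 / 40 * nearestDist y i < dist (y i) (y k) := fun k hk => by
    have h := Finset.mem_filter.1 hk
    exact ⟨h.1, not_le.1 h.2⟩
  have m2 : ∀ k ∈ T₂, k ∈ T ∧ 8 * nearestDist y i < dist (y i) (y k) := fun k hk => by
    have h := Finset.mem_filter.1 hk
    exact ⟨(m1 k h.1).1, not_le.1 h.2⟩
  have m3 : ∀ k ∈ T₃, k ∈ T ∧ 47 / 5 * nearestDist y i < dist (y i) (y k) := fun k hk => by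
    have h := Finset.mem_filter.1 hk
    exact ⟨(m2 k h.1).1, not_le.1 h.2⟩
  have m4 : ∀ k ∈ T₄, k ∈ T ∧ 101 / 10 * nearestDist y i < dist (y i) (y k) := fun k hk => by
    have h := Finset.mem_filter.1 hk
    exact ⟨(m3 k h.1).1, not_le.1 h.2⟩
  have m5 : ∀ k ∈ T₅, k ∈ T ∧ 21 / 2 * nearestDist y i < dist (y i) (y k) := fun k hk => by
    have h := Finset.mem_filter.1 hk
    exact ⟨(m4 k h.1).1, not_le.1 h.2⟩
  -- the six pieces
  have b1 : ∑ k ∈ T.filter (fun k => dist (y i) (y k) ≤ 219 / 40 * nearestDist y i), (dist (y i) (y k))⁻¹ ^ 6 ≤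
      193 / 1000 * (nearestDist y i)⁻¹ ^ 6 :=
    piece1_sum_le hy hν hreg _ fun k hk => by
      have h := Finset.mem_filter.1 hk
      exact ⟨(hT k h.1).1, h.2⟩
  have b2 : ∑ k ∈ T₁.filter (fun k => dist (y i) (y k) ≤ 8 * nearestDist y i), (dist (y i) (y k))⁻¹ ^ 6 ≤
      11 / 100 * (nearestDist y i)⁻¹ ^ 6 :=
    piece2_sum_le hy hν hreg _ fun k hk => by
      have h := Finset.mem_filter.1 hk
      exact ⟨(m1 k h.1).2, h.2⟩
  have b3 : ∑ k ∈ T₂.filter (fun k => dist (y i) (y k) ≤ 47 / 5 * nearestDist y i), (dist (y i) (y k))⁻¹ ^ 6 ≤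
      47 / 2000 * (nearestDist y i)⁻¹ ^ 6 :=
    piece3_sum_le hy hν hreg _ fun k hk => by
      have h := Finset.mem_filter.1 hk
      exact ⟨(m2 k h.1).2, h.2⟩
  have b4 : ∑ k ∈ T₃.filter (fun k => dist (y i) (y k) ≤ 101 / 10 * nearestDist y i), (dist (y i) (y k))⁻¹ ^ 6 ≤
      1 / 100 * (nearestDist y i)⁻¹ ^ 6 :=
    piece4_sum_le hy hν hreg _ fun k hk => by
      have h := Finset.mem_filter.1 hk
      exact ⟨(m3 k h.1).2, h.2⟩
  have b5 : ∑ k ∈ T₄.filter (fun k => dist (y i) (y k) ≤ 21 / 2 * nearestDist y i), (dist (y i) (y k))⁻¹ ^ 6 ≤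
      13 / 2000 * (nearestDist y i)⁻¹ ^ 6 :=
    piece5_sum_le hy hν hreg _ fun k hk => by
      have h := Finset.mem_filter.1 hk
      exact ⟨(m4 k h.1).2, h.2⟩
  have b6 : ∑ k ∈ T₅, (dist (y i) (y k))⁻¹ ^ 6 ≤ 51 / 1000 * (nearestDist y i)⁻¹ ^ 6 :=
    piece6_sum_le hy i hν _ (fun k hk => ⟨(m5 k hk).2, (hT k (m5 k hk).1).2.1⟩) (fun k hk => (hT k (m5 k hk).1).2.2.le)
  linarith [s1, s2, s3, s4, s5, b1, b2, b3, b4, b5, b6]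

/-- ★ **THE OUTER BOOKKEEPING OF THE LEAF**: at a priced, `(12, 10⁻⁴, 10⁻³)`-affinely deep site `i`,
`∑_{d_k ≤ 106/25·nn_i} min (½V(d_k)) (V(d_k)) − (197/3000)·nn_i⁻⁶ ≤ nearLoad 64 12 (1/10^4) (1/1000) (17/50) (17/20) (3/50) (1/450) δ 12 y i`. [this file] -/
theorem inner_sub_tail_le_nearLoad {δ : ℝ} (hδ : 0 < δ) {y : Fin N → EuclideanSpace ℝ (Fin 3)} (hy : Function.Injective y) {i : Fin N}
    (hi : Priced 64 12 (1 / 10 ^ 4) (1 / 1000) (17 / 50) (17 / 20) (3 / 50) (1 / 450) δ y i)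
    (hreg : AffDeepReg 12 (1 / 10 ^ 4) (1 / 1000) (1 / 450) y i) :
    ∑ k ∈ Finset.univ.filter (fun k => dist (y i) (y k) ≤ 106 / 25 * nearestDist y i),
        min (1 / 2 * lennardJones (dist (y i) (y k))) (lennardJones (dist (y i) (y k)))
      - 197 / 3000 * (nearestDist y i)⁻¹ ^ 6
      ≤ nearLoad 64 12 (1 / 10 ^ 4) (1 / 1000) (17 / 50) (17 / 20) (3 / 50) (1 / 450) δ 12 y i := by
  have hν : 0 < nearestDist y i := nearestDist_pos_of_priced hδ hi
  have hν1 : nearestDist y i < 17 / 20 := by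
    rcases hi.2 with h | h
    · linarith
    · exact h.2
  unfold nearLoad
  set S₁ := Finset.univ.filter (fun k => Priced 64 12 (1 / 10 ^ 4) (1 / 1000) (17 / 50) (17 / 20) (3 / 50) (1 / 450) δ y k ∧
    dist (y i) (y k) ≤ 12 * nearestDist y i) with hS₁
  set S₂ := Finset.univ.filter (fun k => (Sound 64 (3 / 50) (1 / 450) δ y k ∧
    ¬ Priced 64 12 (1 / 10 ^ 4) (1 / 1000) (17 / 50) (17 / 20) (3 / 50) (1 / 450) δ y k) ∧ dist (y i) (y k) ≤ 12 * nearestDist y i) with hS₂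
  set S₃ := Finset.univ.filter (fun k => ¬ Sound 64 (3 / 50) (1 / 450) δ y k ∧ dist (y i) (y k) ≤ 12 * nearestDist y i) with hS₃
  set Near := Finset.univ.filter (fun k => dist (y i) (y k) ≤ 12 * nearestDist y i) with hNear
  set φ : Fin N → ℝ := fun k => if dist (y i) (y k) ≤ 106 / 25 * nearestDist y i then
      min (1 / 2 * lennardJones (dist (y i) (y k))) (lennardJones (dist (y i) (y k)))
    else -(if 2 / 5 * nearestDist y i < nearestDist y k then 1 / 6 * (dist (y i) (y k))⁻¹ ^ 6 else 0) with hφ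
  have hdpos : ∀ k, ¬ dist (y i) (y k) ≤ 106 / 25 * nearestDist y i → 0 < dist (y i) (y k) := fun k hd =>
    lt_of_lt_of_le (by positivity) (not_le.1 hd).le
  -- (1) termwise comparisons
  have h1 : ∀ k ∈ S₁, φ k ≤ scaleWeight y i k * lennardJones (dist (y i) (y k)) := by
    intro k hk
    simp only [hφ]
    by_cases hin : dist (y i) (y k) ≤ 106 / 25 * nearestDist y i
    · rw [if_pos hin]
      by_cases hki : k = i
      · subst hki
        simp [lennardJones_zero]
      · have hfl : 9 / 10 * nearestDist y i ≤ nearestDist y k :=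
          (core_scale_window hy hν hreg k (by rw [dist_comm]; linarith)).1
        have hw : 1 / 2 ≤ scaleWeight y i k := by
          have hnot : ¬ nearestDist y k ≤ 2 / 5 * nearestDist y i := by
            intro h
            linarith
          unfold scaleWeight
          rw [if_neg hnot]
          split_ifs <;> norm_num
        have hw1 := scaleWeight_le_one y i k
        by_cases hV : 0 ≤ lennardJones (dist (y i) (y k))
        · refine (min_le_left _ _).trans ?_
          nlinarith [mul_nonneg (sub_nonneg.2 hw) hV]
        · refine (min_le_right _ _).trans ?_
          nlinarith [mul_nonneg (sub_nonneg.2 hw1) (neg_nonneg.2 (not_le.1 hV).le)]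
    · rw [if_neg hin]
      by_cases hc : 2 / 5 * nearestDist y i < nearestDist y k
      · rw [if_pos hc]
        exact neg_le_mul_lennardJones (scaleWeight_nonneg y i k) (scaleWeight_le_one y i k) (hdpos k hin)
      · rw [if_neg hc, neg_zero]
        have hw0 : scaleWeight y i k = 0 := by
          unfold scaleWeight
          rw [if_pos (not_lt.1 hc)]
        rw [hw0, zero_mul]
  have h2 : ∀ k ∈ S₂, φ k ≤ lennardJones (dist (y i) (y k)) := by
    intro k hk
    have hk' := (Finset.mem_filter.1 hk).2
    simp only [hφ]
    by_cases hin : dist (y i) (y k) ≤ 106 / 25 * nearestDist y i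
    · rw [if_pos hin]
      exact min_le_right _ _
    · have hnk : 2 / 5 * nearestDist y i < nearestDist y k := by
        have h17 : 17 / 50 ≤ nearestDist y k := not_lt.1 fun h => hk'.1.2 ⟨hk'.1.1, Or.inl h⟩
        linarith
      rw [if_neg hin, if_pos hnk]
      exact neg_le_lennardJones_of_le (hdpos k hin) le_rfl
  have h3 : ∀ k ∈ S₃, φ k ≤ max (lennardJones (dist (y i) (y k))) 0 := by
    intro k _
    simp only [hφ]
    by_cases hin : dist (y i) (y k) ≤ 106 / 25 * nearestDist y i
    · rw [if_pos hin]
      exact (min_le_right _ _).trans (le_max_left _ _)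
    · rw [if_neg hin]
      refine le_trans ?_ (le_max_right _ _)
      rw [neg_nonpos]
      split_ifs
      · positivity
      · exact le_rfl
  -- (2) the three near classes partition the near ball
  have hpart : ∑ k ∈ Near, φ k = ∑ k ∈ S₁, φ k + ∑ k ∈ S₂, φ k + ∑ k ∈ S₃, φ k := by
    rw [← Finset.sum_filter_add_sum_filter_not Near
        (fun k => Priced 64 12 (1 / 10 ^ 4) (1 / 1000) (17 / 50) (17 / 20) (3 / 50) (1 / 450) δ y k),
      ← Finset.sum_filter_add_sum_filter_not
        (Near.filter fun k => ¬ Priced 64 12 (1 / 10 ^ 4) (1 / 1000) (17 / 50) (17 / 20) (3 / 50) (1 / 450) δ y k)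
        (fun k => Sound 64 (3 / 50) (1 / 450) δ y k)]
    have e1 : Near.filter (fun k => Priced 64 12 (1 / 10 ^ 4) (1 / 1000) (17 / 50) (17 / 20) (3 / 50) (1 / 450) δ y k) = S₁ := by
      ext k
      simp only [hNear, hS₁, Finset.mem_filter, Finset.mem_univ, true_and]
      tauto
    have e2 : (Near.filter fun k => ¬ Priced 64 12 (1 / 10 ^ 4) (1 / 1000) (17 / 50) (17 / 20) (3 / 50) (1 / 450) δ y k).filter
        (fun k => Sound 64 (3 / 50) (1 / 450) δ y k) = S₂ := by
      ext k
      simp only [hNear, hS₂, Finset.mem_filter, Finset.mem_univ, true_and]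
      tauto
    have e3 : (Near.filter fun k => ¬ Priced 64 12 (1 / 10 ^ 4) (1 / 1000) (17 / 50) (17 / 20) (3 / 50) (1 / 450) δ y k).filter
        (fun k => ¬ Sound 64 (3 / 50) (1 / 450) δ y k) = S₃ := by
      ext k
      simp only [hNear, hS₃, Finset.mem_filter, Finset.mem_univ, true_and]
      constructor
      · rintro ⟨⟨hn, -⟩, hS⟩
        exact ⟨hS, hn⟩
      · rintro ⟨hS, hn⟩
        exact ⟨⟨hn, fun hP => hS hP.1⟩, hS⟩
    rw [e1, e2, e3]
    ring
  -- (3) the near sum of `φ`: the inner worst-case sum minus the pullers' tail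
  set Inner := Finset.univ.filter (fun k => dist (y i) (y k) ≤ 106 / 25 * nearestDist y i) with hInner
  set T := (Near.filter fun k => ¬ dist (y i) (y k) ≤ 106 / 25 * nearestDist y i).filter
    (fun k => 2 / 5 * nearestDist y i < nearestDist y k) with hT
  have hNφ : ∑ k ∈ Near, φ k = ∑ k ∈ Inner, min (1 / 2 * lennardJones (dist (y i) (y k))) (lennardJones (dist (y i) (y k)))
      - 1 / 6 * ∑ k ∈ T, (dist (y i) (y k))⁻¹ ^ 6 := by
    rw [← Finset.sum_filter_add_sum_filter_not Near (fun k => dist (y i) (y k) ≤ 106 / 25 * nearestDist y i)]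
    have eI : Near.filter (fun k => dist (y i) (y k) ≤ 106 / 25 * nearestDist y i) = Inner := by
      ext k
      simp only [hNear, hInner, Finset.mem_filter, Finset.mem_univ, true_and]
      constructor
      · rintro ⟨-, h⟩
        exact h
      · intro h
        exact ⟨by linarith [hν.le], h⟩
    have eA : ∑ k ∈ Near.filter (fun k => dist (y i) (y k) ≤ 106 / 25 * nearestDist y i), φ k =
        ∑ k ∈ Near.filter (fun k => dist (y i) (y k) ≤ 106 / 25 * nearestDist y i),
          min (1 / 2 * lennardJones (dist (y i) (y k))) (lennardJones (dist (y i) (y k))) :=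
      Finset.sum_congr rfl fun k hk => by
        simp only [hφ]
        rw [if_pos (Finset.mem_filter.1 hk).2]
    have eB : ∑ k ∈ Near.filter (fun k => ¬ dist (y i) (y k) ≤ 106 / 25 * nearestDist y i), φ k =
        ∑ k ∈ Near.filter (fun k => ¬ dist (y i) (y k) ≤ 106 / 25 * nearestDist y i),
          -(if 2 / 5 * nearestDist y i < nearestDist y k then 1 / 6 * (dist (y i) (y k))⁻¹ ^ 6 else 0) :=
      Finset.sum_congr rfl fun k hk => by
        simp only [hφ]
        rw [if_neg (Finset.mem_filter.1 hk).2]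
    have eC : ∑ k ∈ Near.filter (fun k => ¬ dist (y i) (y k) ≤ 106 / 25 * nearestDist y i),
        (if 2 / 5 * nearestDist y i < nearestDist y k then 1 / 6 * (dist (y i) (y k))⁻¹ ^ 6 else 0) =
          1 / 6 * ∑ k ∈ T, (dist (y i) (y k))⁻¹ ^ 6 := by
      rw [Finset.mul_sum]
      exact (Finset.sum_filter _ _).symm
    rw [eA, eB, Finset.sum_neg_distrib, eC, eI]
    ring
  -- (4) the pullers' tail by «Pieces»
  have hTsum : ∑ k ∈ T, (dist (y i) (y k))⁻¹ ^ 6 ≤ 394 / 1000 * (nearestDist y i)⁻¹ ^ 6 := by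
    refine pullers_sum_le hy hν hreg T fun k hk => ?_
    have h := Finset.mem_filter.1 hk
    have h' := Finset.mem_filter.1 h.1
    exact ⟨not_le.1 h'.2, (Finset.mem_filter.1 h'.1).2, h.2⟩
  -- (5) assemble
  linarith [Finset.sum_le_sum h1, Finset.sum_le_sum h2, Finset.sum_le_sum h3, hpart, hNφ, hTsum]

end Summit.AtomisticToContinuum.Crystallization.Theorems.OverbindingBudgetAffineCompressedCutOuter
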